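import Summits.Ventures.PercRepro.Night2HitLoad
import Summits.Ventures.PercRepro.Night2NonFatLevelAny

/-!
# night-2: THE HITTING TARGETS — capacity `≥ 11/18` and their number (gen 39)

A target `Q ∪ Y` of a lossy basis pair is HITTING when `Y ⊄ cl (Q.erase w)` for every active face `w` (every `w ∈ Q′` with
`faceOk Q w`): then no active face is a coloop face of the target, `L1 = 0`, and at an unloaded target
**`vCap (Q ∪ Y) ≥ 11/18`** (`vCap_ge_of_hitting`, from gen 37's `vCap_union_ge` with an empty support sum).
Every active face has at least two hole points (`two_le_card_holes`), so a non-hitting `Y` of size `i` lies inside one of the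
at most five sets `W ∩ cl (Q.erase w)` of size `≤ |W| − 2`: **`card_filter_hitting_ge`** — the hitting `i`-subsets of `W`
number at least `C(N, i) − 5 · C(N − 2, i)` (Bonferroni; `card_filter_forall_not_subset_ge` is the abstract count).
Paper: proofs/NIGHT-2-g39.md §2.
-/

namespace PercRepro.Shadow

open PercRepro.ThmH PercRepro.PerFlat

variable {α : Type*} [DecidableEq α] {M : Matroid α} [M.Finite] {G : Finset α}

/-- **The capacity of an unloaded hitting target is at least `11/18`.** -/
theorem vCap_ge_of_hitting (hG : G ∈ flatsQ M (5 + 1)) (hd : (gr M \ G).card = 2) (hk : kColoops M G = 1)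
    {B : Finset α} (hB : B ∈ thinMembers M 5 G) (hnP : ¬ bigP M G B) {z : α} (hz : z ∈ G \ clF M B)
    {Y : Finset α} (hY : Y ⊆ G \ insert z B) (hne : Y.Nonempty)
    (hdl : dload M 5 G (bigP M G) (dshGT2 M 5 G) (insert z B ∪ Y) = 0)
    (hhit : ∀ w ∈ (insert z B \ coloops M G).filter (fun w => faceOk M G (insert z B) w),
      ¬ Y ⊆ clF M ((insert z B).erase w)) :
    11 / 18 ≤ vCap M G (insert z B ∪ Y) := by
  have h := vCap_union_ge hG hd hk hB hnP hz hY hne hdl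
  have hempty : (insert z B \ coloops M G).filter
      (fun w => faceOk M G (insert z B) w ∧ Y ⊆ clF M ((insert z B).erase w)) = ∅ := by
    rw [Finset.filter_eq_empty_iff]
    intro w hw hw'
    exact hhit w (Finset.mem_filter.2 ⟨hw, hw'.1⟩) hw'.2
  rw [hempty, Finset.sum_empty, sub_zero] at h
  exact h

/-- **The abstract count**: if each of the sets `C w` (`w ∈ A`) meets `O` in at most `|O| − 2` points, the `i`-subsets of `O`
contained in none of them number at least `C(|O|, i) − |A| · C(|O| − 2, i)`. -/
theorem card_filter_forall_not_subset_ge {β : Type*} (O : Finset α) (A : Finset β) (C : β → Finset α)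
    (hC : ∀ w ∈ A, (C w ∩ O).card + 2 ≤ O.card) (i : ℕ) :
    ((O.card.choose i : ℕ) : ℚ) - (A.card : ℚ) * (((O.card - 2).choose i : ℕ) : ℚ) ≤
      (((O.powersetCard i).filter (fun Y => ∀ w ∈ A, ¬ Y ⊆ C w)).card : ℚ) := by
  have hsplit := Finset.card_filter_add_card_filter_not (s := O.powersetCard i)
    (fun Y => ∀ w ∈ A, ¬ Y ⊆ C w)
  rw [Finset.card_powersetCard] at hsplit
  have hbad : ((O.powersetCard i).filter (fun Y => ¬ ∀ w ∈ A, ¬ Y ⊆ C w)).card ≤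
      A.card * (O.card - 2).choose i := by
    have hsub : (O.powersetCard i).filter (fun Y => ¬ ∀ w ∈ A, ¬ Y ⊆ C w) ⊆
        A.biUnion (fun w => (C w ∩ O).powersetCard i) := by
      intro Y hY
      rw [Finset.mem_filter, Finset.mem_powersetCard] at hY
      obtain ⟨⟨hYO, hYi⟩, hbad⟩ := hY
      obtain ⟨w, hw, hYC⟩ : ∃ w ∈ A, Y ⊆ C w := by
        by_contra h
        exact hbad (fun w hw hYC => h ⟨w, hw, hYC⟩)
      rw [Finset.mem_biUnion]
      exact ⟨w, hw, Finset.mem_powersetCard.2 ⟨Finset.subset_inter hYC hYO, hYi⟩⟩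
    refine le_trans (Finset.card_le_card hsub) ?_
    refine le_trans Finset.card_biUnion_le ?_
    calc ∑ w ∈ A, ((C w ∩ O).powersetCard i).card
        ≤ ∑ _w ∈ A, (O.card - 2).choose i := by
          apply Finset.sum_le_sum
          intro w hw
          rw [Finset.card_powersetCard]
          exact Nat.choose_le_choose i (by have := hC w hw; omega)
      _ = A.card * (O.card - 2).choose i := by rw [Finset.sum_const, smul_eq_mul]
  have h1 : ((((O.powersetCard i).filter (fun Y => ∀ w ∈ A, ¬ Y ⊆ C w)).card : ℕ) : ℚ) +
      ((((O.powersetCard i).filter (fun Y => ¬ ∀ w ∈ A, ¬ Y ⊆ C w)).card : ℕ) : ℚ) =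
      ((O.card.choose i : ℕ) : ℚ) := by exact_mod_cast hsplit
  have h2 : ((((O.powersetCard i).filter (fun Y => ¬ ∀ w ∈ A, ¬ Y ⊆ C w)).card : ℕ) : ℚ) ≤
      (A.card : ℚ) * (((O.card - 2).choose i : ℕ) : ℚ) := by exact_mod_cast hbad
  linarith

/-- **The hitting `i`-subsets of `W` number at least `C(N, i) − 5 · C(N − 2, i)`** (no fat closure: every active face has
`≥ 2` holes, and there are at most five faces). -/
theorem card_filter_hitting_ge (hG : G ∈ flatsQ M (5 + 1)) (hd : (gr M \ G).card = 2) (hk : kColoops M G = 1)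
    (hnf : fatClosures M 5 G 2 = ∅) {B : Finset α} (hB : B ∈ thinMembers M 5 G) (hnP : ¬ bigP M G B) {z : α}
    (hz : z ∈ G \ clF M B) (i : ℕ) :
    (((G \ insert z B).card.choose i : ℕ) : ℚ) - 5 * ((((G \ insert z B).card - 2).choose i : ℕ) : ℚ) ≤
      ((((G \ insert z B).powersetCard i).filter (fun Y =>
        ∀ w ∈ (insert z B \ coloops M G).filter (fun w => faceOk M G (insert z B) w),
          ¬ Y ⊆ clF M ((insert z B).erase w))).card : ℚ) := by
  have hQG : insert z B ⊆ G :=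
    Finset.insert_subset (Finset.mem_sdiff.1 hz).1 (subset_G_of_mem_thinMembers hB)
  have hC : ∀ w ∈ (insert z B \ coloops M G).filter (fun w => faceOk M G (insert z B) w),
      (clF M ((insert z B).erase w) ∩ (G \ insert z B)).card + 2 ≤ (G \ insert z B).card := by
    intro w hw
    have hok := (Finset.mem_filter.1 hw).2
    have h2 := two_le_card_holes hG hnf hQG hok
    have hsplit := Finset.card_sdiff_add_card_inter (G \ insert z B) (clF M ((insert z B).erase w))
    rw [Finset.inter_comm]
    omega
  have hA : ((insert z B \ coloops M G).filter (fun w => faceOk M G (insert z B) w)).card ≤ 5 := by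
    obtain ⟨-, hQ'5⟩ := rkN_insert_sdiff_coloops_eq_five hG hd hk hB hnP hz
    rw [← hQ'5]
    exact Finset.card_filter_le _ _
  have h := card_filter_forall_not_subset_ge (G \ insert z B)
    ((insert z B \ coloops M G).filter (fun w => faceOk M G (insert z B) w))
    (fun w => clF M ((insert z B).erase w)) hC i
  have hA' : (((insert z B \ coloops M G).filter (fun w => faceOk M G (insert z B) w)).card : ℚ) ≤ 5 := by
    exact_mod_cast hA
  have h0 : (0 : ℚ) ≤ ((((G \ insert z B).card - 2).choose i : ℕ) : ℚ) := by positivity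
  nlinarith

end PercRepro.Shadow
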